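import Literature.Barriers.RiemannHypothesis.EpsteinZetaStarkArg
import Literature.Barriers.RiemannHypothesis.EpsteinZetaStarkEdges
import HarnessLib

/-!
# Stark's theorem on the zeros of Epstein zeta functions, IV: the number of zeros in `[−1, 2] × [−T₀, T₀]` (Stark's Lemma 5)

Seventh proof file next to `Literature/Barriers/RiemannHypothesis/EpsteinZetaRealZeros.lean`.
With `P_z(s) = s(s−1)Λ_z(s)` (`Literature.Barriers.RiemannHypothesis.epsteinP`, entire, same zeros as
`ζ(s, Q)` off `s = 0`), `M_z = s(s−1)(2f(s) + 2f(1−s))`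
(`Literature.Barriers.RiemannHypothesis.epsteinMain`) and the height `T₀` of Lemma 3
(`f(½ + iT₀) > 0`, i.e. `θ_k(T₀) = 2πm`, `Literature.Barriers.RiemannHypothesis.exists_starkT₀`),
this file proves Stark's Lemma 5 in the form

`Σ_{ρ ∈ R°, P_z(ρ) = 0} mult(ρ) = 4m + 2`, `R = [−1, 2] × [−T₀, T₀]`
(`Literature.Barriers.RiemannHypothesis.finsum_order_epsteinP_eq`),

under the Rouché hypothesis `|P_z − M_z| < |M_z|` on the quarter boundary `2 → 2 + iT₀ → ½ + iT₀`
(extended to `∂R` by `s ↦ 1 − s`, `s ↦ s̄`). Steps: (1) `M_z ≠ 0` on `∂R` and the logarithmic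
derivative `M_z'/M_z = log k + 2ξ'/ξ(2s) + 1/(s−1) − 1/(s−½) + ρ'/(1+ρ)`, `ρ = f(1−s)/f(s)`
(`|ρ| < 1` on `∂R ∩ {σ > ½}` by the domination of `EpsteinZetaStarkSetup.lean`, `ρ(½+iT₀) = 1`);
(2) the folding lemma `Literature.NumberTheory.LFunctions.rectBoundaryIntegral_eq_of_symmetric` and the
exact evaluation of the five pieces along `2 → 2+iT₀ → ½+iT₀` (`T₀ log k`, `ϑ_ξ(2T₀)` by Cauchy's
theorem on `[½, 2] × [0, T₀]`, `arg(−½ + iT₀)`, `−π/2`, `0`), giving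
`∮_{∂R} M_z'/M_z = 4i(θ_k(T₀) + π)`; (3) `∮ P_z'/P_z = ∮ M_z'/M_z` (`P_z/M_z` has positive real
part on `∂R`, `Literature.Analysis.Complex.integral_boundary_rect_logDeriv_eq_zero_of_mem_slitPlane`);
(4) the argument principle `Literature.Analysis.Complex.integral_boundary_rect_logDeriv`.

## References

* [Stark1967EpsteinZeros] H. M. Stark, Mathematika 14 (1967) 47–55, §3 Lemma 5, §4.
* [Titchmarsh1986] §9.3 (Backlund's evaluation of `∮ ξ'/ξ`).
-/

noncomputable section

open Complex Filter Topology Set MeasureTheory intervalIntegral Metric HurwitzZeta Asymptotics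

open scoped UpperHalfPlane Real ComplexConjugate

namespace Literature.Barriers.RiemannHypothesis

open Literature.NumberTheory.Automorphic
open Literature.NumberTheory.LFunctions
open Literature.Analysis.Complex
open Literature.Analysis.SpecialFunctions

/-! ## `ρ = f(1−s)/f(s)` and `G = k^s ξ(2s)` -/

/-! Below `ρ_z(s)` abbreviates Stark's ratio `f(1 − s)/f(s)` ((23): `f(s) + f(1−s) = f(s)(1 + ρ_z(s))`),
written out as `starkF z (1 - s) / starkF z s`, and `G_z(s)` the entire function `k^s ξ(2s)`
(`f(s) · 2s(2s−1) = 2G_z(s)`), written out as `(k : ℂ) ^ s * riemannXi (2 * s)`. -/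

/-- `f(s) · 2s(2s − 1) = 2 k^s ξ(2s)`. [cite: Stark1967EpsteinZeros, §2 (10)] -/
theorem starkF_mul_eq (z : ℍ) {s : ℂ} (h0 : s ≠ 0) (hh : s ≠ 1 / 2) :
    starkF z s * (2 * s * (2 * s - 1)) = 2 * (((z.im : ℝ) : ℂ) ^ s * riemannXi (2 * s)) := by
  have h2 : 2 * s ≠ 0 := mul_ne_zero two_ne_zero h0
  have h2' : 2 * s ≠ 1 := fun h ↦ hh (by linear_combination h / 2)
  rw [starkF_def, riemannXi_eq_mul_completedRiemannZeta h2 h2']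
  ring

/-- `G_z` is entire. [folklore] -/
theorem differentiable_starkG (z : ℍ) : Differentiable ℂ (fun w : ℂ ↦ ((z.im : ℝ) : ℂ) ^ w * riemannXi (2 * w)) := by
  have hyc : ((z.im : ℝ) : ℂ) ≠ 0 := by exact_mod_cast z.im_pos.ne'
  intro s
  exact (differentiableAt_id.const_cpow (Or.inl hyc)).mul
    ((differentiable_riemannXi _).comp s (differentiableAt_id.const_mul _))

/-- `G_z(s) ≠ 0` where `f(s) ≠ 0` (`s ≠ 0, ½`). [folklore] -/
theorem starkG_ne_zero (z : ℍ) {s : ℂ} (h0 : s ≠ 0) (hh : s ≠ 1 / 2) (hf : starkF z s ≠ 0) :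
    (((z.im : ℝ) : ℂ) ^ s * riemannXi (2 * s)) ≠ 0 := by
  intro h
  have := starkF_mul_eq z h0 hh
  rw [h, mul_zero, mul_eq_zero] at this
  rcases this with h1 | h1
  · exact hf h1
  · have h2 : 2 * s ≠ 0 := mul_ne_zero two_ne_zero h0
    have h2' : 2 * s - 1 ≠ 0 := sub_ne_zero.2 fun h ↦ hh (by linear_combination h / 2)
    exact mul_ne_zero h2 h2' h1

/-- `G_z'/G_z(s) = log k + 2 ξ'/ξ(2s)`. [folklore] -/
theorem logDeriv_starkG (z : ℍ) {s : ℂ} (hξ : riemannXi (2 * s) ≠ 0) :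
    logDeriv (fun w : ℂ ↦ ((z.im : ℝ) : ℂ) ^ w * riemannXi (2 * w)) s =
      (Real.log z.im : ℂ) + 2 * logDeriv riemannXi (2 * s) := by
  have hy := z.im_pos
  have hyc : ((z.im : ℝ) : ℂ) ≠ 0 := by exact_mod_cast hy.ne'
  have hpow : ((z.im : ℝ) : ℂ) ^ s ≠ 0 := by
    rw [Ne, Complex.cpow_eq_zero_iff]; exact fun h ↦ hyc h.1
  have hd1 : HasDerivAt (fun w : ℂ ↦ ((z.im : ℝ) : ℂ) ^ w)
      (((z.im : ℝ) : ℂ) ^ s * Complex.log ((z.im : ℝ) : ℂ)) s := by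
    have := (hasDerivAt_id s).const_cpow (c := ((z.im : ℝ) : ℂ)) (Or.inl hyc)
    simpa using this
  have hl1 : logDeriv (fun w : ℂ ↦ ((z.im : ℝ) : ℂ) ^ w) s = Real.log z.im := by
    rw [logDeriv_apply, hd1.deriv, ← Complex.ofReal_log hy.le]
    field_simp
  have hd2 : DifferentiableAt ℂ (fun w : ℂ ↦ riemannXi (2 * w)) s :=
    (differentiable_riemannXi _).comp s (differentiableAt_id.const_mul _)
  have hl2 : logDeriv (fun w : ℂ ↦ riemannXi (2 * w)) s = 2 * logDeriv riemannXi (2 * s) := by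
    have h := logDeriv_comp (f := riemannXi) (g := fun w : ℂ ↦ 2 * w) (x := s)
      (differentiable_riemannXi _) (differentiableAt_id.const_mul _)
    simp only [Function.comp_def] at h
    have hd : HasDerivAt (fun w : ℂ ↦ 2 * w) 2 s := by
      simpa using (hasDerivAt_id' s).const_mul (2 : ℂ)
    rw [h, hd.deriv]; ring
  rw [logDeriv_mul (f := fun w : ℂ ↦ ((z.im : ℝ) : ℂ) ^ w) (g := fun w : ℂ ↦ riemannXi (2 * w)) s
    hpow hξ hd1.differentiableAt hd2, hl1, hl2]

/-- `f` is analytic away from `0, ½`. [folklore] -/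
theorem analyticAt_starkF (z : ℍ) {s : ℂ} (h0 : s ≠ 0) (hh : s ≠ 1 / 2) :
    AnalyticAt ℂ (starkF z) s := by
  refine analyticAt_iff_eventually_differentiableAt.2 ?_
  filter_upwards [eventually_ne_nhds h0, eventually_ne_nhds hh] with w hw0 hwh
  exact differentiableAt_starkF z hw0 hwh

/-- `ρ_z` is analytic away from `0, ½, 1` where `f ≠ 0`. [folklore] -/
theorem analyticAt_starkRho (z : ℍ) {s : ℂ} (h0 : s ≠ 0) (h1 : s ≠ 1) (hh : s ≠ 1 / 2)
    (hf : starkF z s ≠ 0) : AnalyticAt ℂ (fun w ↦ starkF z (1 - w) / starkF z w) s := by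
  have h10 : 1 - s ≠ 0 := sub_ne_zero.2 (Ne.symm h1)
  have h1h : 1 - s ≠ 1 / 2 := fun h ↦ hh (by linear_combination -h)
  have ha : AnalyticAt ℂ (fun w ↦ starkF z (1 - w)) s :=
    (analyticAt_starkF z h10 h1h).comp (analyticAt_const.sub analyticAt_id)
  exact ha.div (analyticAt_starkF z h0 hh) hf

/-- `ρ_z(s̄) = conj ρ_z(s)`. [folklore] -/
theorem starkRho_conj (z : ℍ) (s : ℂ) : (starkF z (1 - (conj s)) / starkF z (conj s)) = conj ((starkF z (1 - s) / starkF z s)) := by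
  rw [map_div₀, ← starkF_conj, ← starkF_conj, map_sub, map_one]

/-- On the right edge (`k ≥ 2`): `|ρ_z(2 + it)| ≤ ¼`. [cite: Stark1967EpsteinZeros, §3 Lemma 1] -/
theorem norm_starkRho_right_le (z : ℍ) (hk : 2 ≤ z.im) (y : ℝ) : ‖(starkF z (1 - (2 + y * I)) / starkF z (2 + y * I))‖ ≤ 1 / 4 := by
  have hf : starkF z (2 + y * I) ≠ 0 :=
    starkF_ne_zero z (by norm_num) (fun h ↦ by have := congrArg Complex.re h; norm_num at this)
  rw [norm_div, div_le_iff₀ (norm_pos_iff.2 hf)]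
  exact norm_starkF_one_sub_le_quarter z hk y

/-- On the top edge, right of the critical line (`k ≥ 3`, `|t| ≥ 1`, `½ < σ ≤ 2`): `|ρ_z| < 1`.
[cite: Stark1967EpsteinZeros, §3 Lemma 4] -/
theorem norm_starkRho_lt_one (z : ℍ) (hk : 3 ≤ z.im) {s : ℂ} (hs : 1 / 2 < s.re) (hs2 : s.re ≤ 2)
    (hT : 1 ≤ |s.im|) : ‖(starkF z (1 - s) / starkF z s)‖ < 1 := by
  have hf : starkF z s ≠ 0 := starkF_ne_zero z hs.le (fun h ↦ by rw [h] at hs; norm_num at hs)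
  rw [norm_div, div_lt_one (norm_pos_iff.2 hf)]
  have h := norm_starkF_one_sub_le_exp z hk hs hs2 hT
  have hlt : Real.exp (-((s.re - 1 / 2) * Real.log z.im)) < 1 := by
    rw [Real.exp_lt_one_iff]
    have : 0 < Real.log z.im := Real.log_pos (by linarith)
    nlinarith
  calc ‖starkF z (1 - s)‖ ≤ Real.exp (-((s.re - 1 / 2) * Real.log z.im)) * ‖starkF z s‖ := h
    _ < 1 * ‖starkF z s‖ := mul_lt_mul_of_pos_right hlt (norm_pos_iff.2 hf)
    _ = ‖starkF z s‖ := one_mul _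

/-- `1 + ρ` has positive real part when `|ρ| < 1`: this is Mathlib's
`Complex.mem_slitPlane_of_norm_lt_one`; use that directly. [folklore] -/
@[deprecated Complex.mem_slitPlane_of_norm_lt_one (since := "2026-08-15")]
theorem one_add_mem_slitPlane_of_norm_lt_one {ρ : ℂ} (h : ‖ρ‖ < 1) : 1 + ρ ∈ slitPlane :=
  Complex.mem_slitPlane_of_norm_lt_one h

/-- At the corner `½ + iT` with `f(½ + iT) > 0`: `ρ_z(½ + iT) = 1`. [cite: Stark1967EpsteinZeros, §3 Lemma 5 (proof)] -/
theorem starkRho_corner (z : ℍ) {T : ℝ} (hT : 0 < T)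
    (hpos : starkF z (1 / 2 + T * I) = ‖starkF z (1 / 2 + T * I)‖) :
    (starkF z (1 - (1 / 2 + T * I)) / starkF z (1 / 2 + T * I)) = 1 := by
  have hf : starkF z (1 / 2 + T * I) ≠ 0 :=
    starkF_ne_zero z (by simp) (fun h ↦ by have := congrArg Complex.im h; simp at this; linarith)
  have e : 1 - (1 / 2 + (T : ℂ) * I) = conj (1 / 2 + T * I) := by
    apply Complex.ext <;> simp; norm_num
  rw [e, starkF_conj, div_eq_one_iff_eq hf]
  rw [hpos]
  exact Complex.conj_ofReal _

/-- `1 + ρ_z` lies in the slit plane along the top edge `[½, 2] + iT` (`k ≥ 3`, `T ≥ 1`, `f(½+iT) > 0`).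
[cite: Stark1967EpsteinZeros, §3 Lemma 5 (proof)] -/
theorem one_add_starkRho_top_mem (z : ℍ) (hk : 3 ≤ z.im) {T : ℝ} (hT : 1 ≤ T)
    (hpos : starkF z (1 / 2 + T * I) = ‖starkF z (1 / 2 + T * I)‖) {x : ℝ} (hx : x ∈ Icc (1 / 2 : ℝ) 2) :
    1 + (starkF z (1 - (x + T * I)) / starkF z (x + T * I)) ∈ slitPlane := by
  rcases hx.1.eq_or_lt with h | h
  · rw [← h, show (((1 / 2 : ℝ) : ℂ)) = 1 / 2 by push_cast; ring, starkRho_corner z (by linarith) hpos]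
    exact Or.inl (by norm_num)
  · exact Complex.mem_slitPlane_of_norm_lt_one
      (norm_starkRho_lt_one z hk (by simpa using h) (by simpa using hx.2) (by simp [abs_of_pos (show (0:ℝ) < T by linarith)]; linarith))

/-- `1 + ρ_z` lies in the slit plane along the right edge `2 + it` (`k ≥ 2`). [cite: Stark1967EpsteinZeros, §3 Lemma 5 (proof)] -/
theorem one_add_starkRho_right_mem (z : ℍ) (hk : 2 ≤ z.im) (y : ℝ) :
    1 + (starkF z (1 - (2 + y * I)) / starkF z (2 + y * I)) ∈ slitPlane :=
  Complex.mem_slitPlane_of_norm_lt_one ((norm_starkRho_right_le z hk y).trans_lt (by norm_num))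

/-! ## `M_z` as a product and its logarithmic derivative -/

/-- `M_z(s) = s(s−1) · 2f(s) · (1 + ρ_z(s))` off `{0, ½, 1}` where `f(s) ≠ 0`.
[cite: Stark1967EpsteinZeros, §3 (23)] -/
theorem epsteinMain_eq_prod (z : ℍ) (hy : 1 ≤ z.im) {s : ℂ} (h0 : s ≠ 0) (h1 : s ≠ 1)
    (hh : s ≠ 1 / 2) (hf : starkF z s ≠ 0) :
    epsteinMain z s = s * (s - 1) * (2 * starkF z s) * (1 + (starkF z (1 - s) / starkF z s)) := by
  rw [epsteinMain_eq z hy h0 h1 hh]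
  field_simp

/-- `M_z(s) = G_z(s) (s − 1) (s − ½)⁻¹ (1 + ρ_z(s))` off `{0, ½, 1}` where `f(s) ≠ 0`. [folklore] -/
theorem epsteinMain_eq_starkG_mul (z : ℍ) (hy : 1 ≤ z.im) {s : ℂ} (h0 : s ≠ 0) (h1 : s ≠ 1)
    (hh : s ≠ 1 / 2) (hf : starkF z s ≠ 0) :
    epsteinMain z s = (((z.im : ℝ) : ℂ) ^ s * riemannXi (2 * s)) * ((s - 1) * (s - 1 / 2)⁻¹) * (1 + (starkF z (1 - s) / starkF z s)) := by
  have hE := starkF_mul_eq z h0 hh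
  have hG : (((z.im : ℝ) : ℂ) ^ s * riemannXi (2 * s)) = starkF z s * (s * (2 * s - 1)) := by linear_combination (-(1 : ℂ) / 2) * hE
  have h2s1 : 2 * s - 1 ≠ 0 := sub_ne_zero.2 fun h ↦ hh (by linear_combination h / 2)
  have e : (s - 1 / 2)⁻¹ = 2 * (2 * s - 1)⁻¹ := by
    rw [show s - 1 / 2 = (2 * s - 1) / 2 by ring, inv_div, div_eq_mul_inv]
  rw [epsteinMain_eq_prod z hy h0 h1 hh hf, hG, e]
  calc s * (s - 1) * (2 * starkF z s) * (1 + (starkF z (1 - s) / starkF z s))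
      = starkF z s * s * (s - 1) * (1 + (starkF z (1 - s) / starkF z s)) * (2 * ((2 * s - 1) * (2 * s - 1)⁻¹)) := by
        rw [mul_inv_cancel₀ h2s1]; ring
    _ = starkF z s * (s * (2 * s - 1)) * ((s - 1) * (2 * (2 * s - 1)⁻¹)) * (1 + (starkF z (1 - s) / starkF z s)) := by ring

/-- `M_z ≠ 0` off `{0, ½, 1}` where `f ≠ 0` and `1 + ρ_z ≠ 0`. [folklore] -/
theorem epsteinMain_ne_zero_of (z : ℍ) (hy : 1 ≤ z.im) {s : ℂ} (h0 : s ≠ 0) (h1 : s ≠ 1)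
    (hh : s ≠ 1 / 2) (hf : starkF z s ≠ 0) (hρ : 1 + (starkF z (1 - s) / starkF z s) ≠ 0) : epsteinMain z s ≠ 0 := by
  rw [epsteinMain_eq_prod z hy h0 h1 hh hf]
  exact mul_ne_zero (mul_ne_zero (mul_ne_zero h0 (sub_ne_zero.2 h1)) (mul_ne_zero two_ne_zero hf)) hρ

/-- **The logarithmic derivative of `M_z`** off `{0, ½, 1}` where `f ≠ 0`, `1 + ρ_z ≠ 0`:
`M_z'/M_z(s) = log k + 2ξ'/ξ(2s) + 1/(s−1) − 1/(s−½) + (1+ρ_z)'/(1+ρ_z)(s)`.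
[cite: Stark1967EpsteinZeros, §3 Lemma 5 (proof)] -/
theorem logDeriv_epsteinMain_eq (z : ℍ) (hy : 1 ≤ z.im) {s : ℂ} (h0 : s ≠ 0) (h1 : s ≠ 1)
    (hh : s ≠ 1 / 2) (hf : starkF z s ≠ 0) (hρ : 1 + (starkF z (1 - s) / starkF z s) ≠ 0) :
    deriv (epsteinMain z) s / epsteinMain z s =
      (Real.log z.im : ℂ) + 2 * logDeriv riemannXi (2 * s) + (s - 1)⁻¹ - (s - 1 / 2)⁻¹ +
        logDeriv (fun w ↦ 1 + (starkF z (1 - w) / starkF z w)) s := by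
  set Pf : ℂ → ℂ := fun w ↦ (((z.im : ℝ) : ℂ) ^ w * riemannXi (2 * w)) * ((w - 1) * (w - 1 / 2)⁻¹) * (1 + (starkF z (1 - w) / starkF z w)) with hPf
  -- `M = Π` near `s`
  have hfne : ∀ᶠ w in 𝓝 s, starkF z w ≠ 0 :=
    (differentiableAt_starkF z h0 hh).continuousAt.eventually_ne hf
  have hev : epsteinMain z =ᶠ[𝓝 s] Pf := by
    filter_upwards [eventually_ne_nhds h0, eventually_ne_nhds h1, eventually_ne_nhds hh, hfne]
      with w hw0 hw1 hwh hwf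
    exact epsteinMain_eq_starkG_mul z hy hw0 hw1 hwh hwf
  rw [hev.deriv_eq, hev.eq_of_nhds, ← logDeriv_apply]
  -- the factors
  have hh' : s - 1 / 2 ≠ 0 := sub_ne_zero.2 hh
  have h1' : s - 1 ≠ 0 := sub_ne_zero.2 h1
  have hG0 : (((z.im : ℝ) : ℂ) ^ s * riemannXi (2 * s)) ≠ 0 := starkG_ne_zero z h0 hh hf
  have hξ : riemannXi (2 * s) ≠ 0 := by
    intro h; apply hG0; simp [h]
  have hGd : DifferentiableAt ℂ (fun w : ℂ ↦ ((z.im : ℝ) : ℂ) ^ w * riemannXi (2 * w)) s :=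
    differentiable_starkG z s
  have hL1 : HasDerivAt (fun w : ℂ ↦ w - 1) 1 s := (hasDerivAt_id' s).sub_const 1
  have hL2 : HasDerivAt (fun w : ℂ ↦ (w - 1 / 2)⁻¹) (-1 / (s - 1 / 2) ^ 2) s :=
    ((hasDerivAt_id' s).sub_const (1 / 2 : ℂ)).inv hh'
  have hρd : DifferentiableAt ℂ (fun w ↦ 1 + (starkF z (1 - w) / starkF z w)) s :=
    (analyticAt_const.add (analyticAt_starkRho z h0 h1 hh hf)).differentiableAt
  have hl3 : logDeriv (fun w : ℂ ↦ w - 1) s = (s - 1)⁻¹ := by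
    rw [logDeriv_apply, hL1.deriv, inv_eq_one_div]
  have hl4 : logDeriv (fun w : ℂ ↦ (w - 1 / 2)⁻¹) s = -(s - 1 / 2)⁻¹ := by
    rw [logDeriv_apply, hL2.deriv]
    field_simp
  have hl34 : logDeriv (fun w : ℂ ↦ (w - 1) * (w - 1 / 2)⁻¹) s = (s - 1)⁻¹ - (s - 1 / 2)⁻¹ := by
    rw [logDeriv_mul (f := fun w : ℂ ↦ w - 1) (g := fun w : ℂ ↦ (w - 1 / 2)⁻¹) s h1' (inv_ne_zero hh')
      hL1.differentiableAt hL2.differentiableAt, hl3, hl4]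
    ring
  have h34d : DifferentiableAt ℂ (fun w : ℂ ↦ (w - 1) * (w - 1 / 2)⁻¹) s :=
    hL1.differentiableAt.mul hL2.differentiableAt
  have h34ne : (s - 1) * (s - 1 / 2)⁻¹ ≠ 0 := mul_ne_zero h1' (inv_ne_zero hh')
  have hlA : logDeriv (fun w : ℂ ↦ (((z.im : ℝ) : ℂ) ^ w * riemannXi (2 * w)) * ((w - 1) * (w - 1 / 2)⁻¹)) s =
      (Real.log z.im : ℂ) + 2 * logDeriv riemannXi (2 * s) + ((s - 1)⁻¹ - (s - 1 / 2)⁻¹) := by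
    rw [logDeriv_mul (f := fun w : ℂ ↦ ((z.im : ℝ) : ℂ) ^ w * riemannXi (2 * w))
      (g := fun w : ℂ ↦ (w - 1) * (w - 1 / 2)⁻¹) s hG0 h34ne hGd h34d,
      logDeriv_starkG z hξ, hl34]
  have hAd : DifferentiableAt ℂ (fun w : ℂ ↦ (((z.im : ℝ) : ℂ) ^ w * riemannXi (2 * w)) * ((w - 1) * (w - 1 / 2)⁻¹)) s := hGd.mul h34d
  have hAne : (((z.im : ℝ) : ℂ) ^ s * riemannXi (2 * s)) * ((s - 1) * (s - 1 / 2)⁻¹) ≠ 0 := mul_ne_zero hG0 h34ne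
  rw [hPf, logDeriv_mul (f := fun w : ℂ ↦ (((z.im : ℝ) : ℂ) ^ w * riemannXi (2 * w)) * ((w - 1) * (w - 1 / 2)⁻¹))
    (g := fun w ↦ 1 + (starkF z (1 - w) / starkF z w)) s hAne hρ hAd hρd, hlA]
  ring

/-- `M_z'/M_z` is odd under `s ↦ 1 − s`. [folklore] -/
theorem logDerivM_one_sub (z : ℍ) (hy : 1 ≤ z.im) (s : ℂ) :
    deriv (epsteinMain z) (1 - s) / epsteinMain z (1 - s) = -(deriv (epsteinMain z) s / epsteinMain z s) := by
  rw [deriv_epsteinMain_one_sub z hy, epsteinMain_one_sub, neg_div]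

/-- `M_z'/M_z` commutes with conjugation. [folklore] -/
theorem logDerivM_conj (z : ℍ) (s : ℂ) :
    deriv (epsteinMain z) (conj s) / epsteinMain z (conj s) = conj (deriv (epsteinMain z) s / epsteinMain z s) := by
  rw [deriv_epsteinMain_conj, epsteinMain_conj, map_div₀]

/-! ## `M_z ≠ 0` on the boundary of `R = [−1, 2] × [−T, T]` -/

/-- `M_z(2 + iy) ≠ 0` (`k ≥ 2`, here `k ≥ 3`). [cite: Stark1967EpsteinZeros, §3 Lemma 5 (proof)] -/
theorem epsteinMain_ne_zero_right (z : ℍ) (hk : 3 ≤ z.im) (y : ℝ) : epsteinMain z (2 + y * I) ≠ 0 := by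
  refine epsteinMain_ne_zero_of z (by linarith) ?_ ?_ ?_ ?_ (slitPlane_ne_zero (one_add_starkRho_right_mem z (by linarith) y))
  · intro h; have := congrArg Complex.re h; norm_num at this
  · intro h; have := congrArg Complex.re h; norm_num at this
  · intro h; have := congrArg Complex.re h; norm_num at this
  · exact starkF_ne_zero z (by norm_num) (fun h ↦ by have := congrArg Complex.re h; norm_num at this)

/-- `M_z(x + iT) ≠ 0` for `½ ≤ x ≤ 2` (`k ≥ 3`, `T ≥ 1`, `f(½ + iT) > 0`).
[cite: Stark1967EpsteinZeros, §3 Lemma 5 (proof)] -/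
theorem epsteinMain_ne_zero_top (z : ℍ) (hk : 3 ≤ z.im) {T : ℝ} (hT : 1 ≤ T)
    (hpos : starkF z (1 / 2 + T * I) = ‖starkF z (1 / 2 + T * I)‖) {x : ℝ} (hx : x ∈ Icc (1 / 2 : ℝ) 2) :
    epsteinMain z (x + T * I) ≠ 0 := by
  have hT0 : 0 < T := by linarith
  refine epsteinMain_ne_zero_of z (by linarith) ?_ ?_ ?_ ?_
    (slitPlane_ne_zero (one_add_starkRho_top_mem z hk hT hpos hx))
  · intro h; have := congrArg Complex.im h; simp at this; linarith
  · intro h; have := congrArg Complex.im h; simp at this; linarith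
  · intro h; have := congrArg Complex.im h; simp at this; linarith
  · exact starkF_ne_zero z (by simpa using hx.1)
      (fun h ↦ by have := congrArg Complex.im h; simp at this; linarith)

/-- `M_z ≠ 0` on the whole right edge and (by `M_z(1 − s) = M_z(s) = conj M_z(s̄)`) on the whole
top edge of `R`. [cite: Stark1967EpsteinZeros, §3 Lemma 5 (proof)] -/
theorem epsteinMain_ne_zero_top' (z : ℍ) (hk : 3 ≤ z.im) {T : ℝ} (hT : 1 ≤ T)
    (hpos : starkF z (1 / 2 + T * I) = ‖starkF z (1 / 2 + T * I)‖) {x : ℝ} (hx : x ∈ Icc (-1 : ℝ) 2) :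
    epsteinMain z (x + T * I) ≠ 0 := by
  rcases le_or_gt (1 / 2 : ℝ) x with h | h
  · exact epsteinMain_ne_zero_top z hk hT hpos ⟨h, hx.2⟩
  · have e : (x : ℂ) + T * I = 1 - conj (((1 - x : ℝ) : ℂ) + T * I) := by
      apply Complex.ext <;> simp
    rw [e, epsteinMain_one_sub, epsteinMain_conj, map_ne_zero_iff _ (RingHom.injective _)]
    exact epsteinMain_ne_zero_top z hk hT hpos ⟨by linarith, by linarith [hx.1]⟩

/-! ## The five pieces of `∮ M_z'/M_z` along `2 → 2 + iT → ½ + iT` -/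

/-- Piece `1/(s − 1)`: contributes `arg(−½ + iT) = π − arg(½ + iT)`. [folklore] -/
theorem piece_inv_sub_one {T : ℝ} (hT : 0 < T) :
    (∫ y in (0 : ℝ)..T, (2 + (y : ℂ) * I - 1)⁻¹).re -
      (∫ x in (1 / 2 : ℝ)..2, ((x : ℂ) + T * I - 1)⁻¹).im = π - Complex.arg (1 / 2 + T * I) := by
  have hT0 : T ≠ 0 := hT.ne'
  rw [show (1 / 2 : ℂ) + T * I = ((1 / 2 : ℝ) : ℂ) + T * I by push_cast; ring]
  have v1 : I * ∫ y in (0 : ℝ)..T, (2 + (y : ℂ) * I - 1)⁻¹ = log (2 + T * I - 1) - log (2 - 1) := by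
    have := Literature.Analysis.Complex.integral_inv_sub_vertical_right 1 2 0 T (by simp)
    simpa using this
  have h1 : ∫ x in (1 / 2 : ℝ)..2, ((x : ℂ) + T * I - 1)⁻¹ =
      log (2 + T * I - 1) - log ((1 / 2 : ℝ) + T * I - 1) := by
    have := Literature.Analysis.Complex.integral_inv_sub_horizontal 1 (1 / 2) 2 T (by simpa using hT0)
    simpa using this
  have hC : (∫ y in (0 : ℝ)..T, (2 + (y : ℂ) * I - 1)⁻¹) = -I * (log (2 + T * I - 1) - log (2 - 1)) := by
    rw [← v1, ← mul_assoc]; simp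
  rw [hC, h1]
  have key := arg_add_arg_neg_conj (z := (1 / 2 : ℝ) + T * I) (by simpa using hT)
  have e1 : -conj (((1 / 2 : ℝ) : ℂ) + T * I) = ((1 / 2 : ℝ) : ℂ) + T * I - 1 := by
    apply Complex.ext <;> norm_num
  rw [e1] at key
  have a1 : arg (2 - 1 : ℂ) = 0 := by norm_num
  simp only [neg_mul, neg_re, mul_re, I_re, I_im, zero_mul, one_mul, zero_sub, neg_neg, sub_im, log_im, a1]
  linarith

/-- Piece `1/(s − ½)`: contributes `π/2`. [folklore] -/
theorem piece_inv_sub_half {T : ℝ} (hT : 0 < T) :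
    (∫ y in (0 : ℝ)..T, (2 + (y : ℂ) * I - 1 / 2)⁻¹).re -
      (∫ x in (1 / 2 : ℝ)..2, ((x : ℂ) + T * I - 1 / 2)⁻¹).im = π / 2 := by
  have hT0 : T ≠ 0 := hT.ne'
  have v1 : I * ∫ y in (0 : ℝ)..T, (2 + (y : ℂ) * I - 1 / 2)⁻¹ =
      log (2 + T * I - 1 / 2) - log (2 - 1 / 2) := by
    have := Literature.Analysis.Complex.integral_inv_sub_vertical_right (1 / 2) 2 0 T (by norm_num)
    simpa using this
  have h1 : ∫ x in (1 / 2 : ℝ)..2, ((x : ℂ) + T * I - 1 / 2)⁻¹ =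
      log (2 + T * I - 1 / 2) - log ((1 / 2 : ℝ) + T * I - 1 / 2) := by
    have := Literature.Analysis.Complex.integral_inv_sub_horizontal (1 / 2) (1 / 2) 2 T (by simpa using hT0)
    simpa using this
  have hC : (∫ y in (0 : ℝ)..T, (2 + (y : ℂ) * I - 1 / 2)⁻¹) =
      -I * (log (2 + T * I - 1 / 2) - log (2 - 1 / 2)) := by
    rw [← v1, ← mul_assoc]; simp
  rw [hC, h1]
  have a1 : arg (2 - 1 / 2 : ℂ) = 0 := by
    rw [show (2 - 1 / 2 : ℂ) = ((3 / 2 : ℝ) : ℂ) by push_cast; norm_num, arg_ofReal_of_nonneg (by norm_num)]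
  have a2 : arg (((1 / 2 : ℝ) : ℂ) + T * I - 1 / 2) = π / 2 := by
    rw [show ((1 / 2 : ℝ) : ℂ) + T * I - 1 / 2 = T * I by push_cast; ring, arg_real_mul _ hT, arg_I]
  simp only [neg_mul, neg_re, mul_re, I_re, I_im, zero_mul, one_mul, zero_sub, neg_neg, sub_im, log_im, a1, a2]
  ring

/-- The function `s ↦ 2ξ'/ξ(2s)` is complex differentiable on `Re s ≥ ½` (`ξ(w) ≠ 0` for `Re w ≥ 1`).
[folklore] -/
theorem differentiableAt_two_mul_logDeriv_xi {s : ℂ} (hs : 1 / 2 ≤ s.re) :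
    DifferentiableAt ℂ (fun w : ℂ ↦ 2 * logDeriv riemannXi (2 * w)) s := by
  have hξ : riemannXi (2 * s) ≠ 0 := riemannXi_ne_zero_of_one_le_re (by simp; linarith)
  have hld : DifferentiableAt ℂ (logDeriv riemannXi) (2 * s) := by
    have h1 : DifferentiableAt ℂ (deriv riemannXi) (2 * s) :=
      (differentiable_riemannXi.analyticAt (2 * s)).deriv.differentiableAt
    exact h1.div (differentiable_riemannXi _) hξ
  exact (hld.comp s (differentiableAt_id.const_mul _)).const_mul _

/-- `ξ'/ξ` is real on the real axis. [folklore] -/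
theorem logDeriv_riemannXi_ofReal_im (x : ℝ) : (logDeriv riemannXi x).im = 0 := by
  have h := logDeriv_riemannXi_conj (x : ℂ)
  rw [Complex.conj_ofReal] at h
  exact Complex.conj_eq_iff_im.1 h.symm

/-- Piece `2ξ'/ξ(2s)`: contributes `ϑ_ξ(2T)` (Cauchy's theorem on `[½, 2] × [0, T]`, the bottom edge
being real and the left edge giving `∫₀ᵀ 2 Re ξ'/ξ(1 + 2iy) dy = ϑ_ξ(2T)`). [folklore] -/
theorem piece_logDeriv_xi {T : ℝ} (hT : 0 ≤ T) :
    (∫ y in (0 : ℝ)..T, 2 * logDeriv riemannXi (2 * (2 + (y : ℂ) * I))).re -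
      (∫ x in (1 / 2 : ℝ)..2, 2 * logDeriv riemannXi (2 * ((x : ℂ) + T * I))).im = xiArg (2 * T) := by
  set G : ℂ → ℂ := fun w ↦ 2 * logDeriv riemannXi (2 * w) with hG
  have hGd : ∀ w : ℂ, 1 / 2 ≤ w.re → DifferentiableAt ℂ G w := fun w hw ↦
    differentiableAt_two_mul_logDeriv_xi hw
  have hCG := Literature.Analysis.Complex.rectBoundaryIntegral_eq_zero_of_differentiableOn (F := G)
    (a := 1 / 2) (b := 2) (c := 0) (d := T) (by norm_num) hT (fun w hw ↦
      (hGd w (mem_reProdIm.1 hw).1.1).differentiableWithinAt)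
  rw [Literature.Analysis.Complex.rectBoundaryIntegral_def] at hCG
  simp only [ofReal_ofNat] at hCG
  -- bottom edge: real values
  have hbot : (∫ x in (1 / 2 : ℝ)..2, G (x + (0 : ℝ) * I)).im = 0 := by
    have hint : IntervalIntegrable (fun x : ℝ ↦ G (x + (0 : ℝ) * I)) volume (1 / 2) 2 :=
      Literature.Analysis.Complex.intervalIntegrable_of_continuousAt_horizontal (F := G) 0 (by norm_num)
        fun x hx ↦ (hGd _ (by simp; linarith [hx.1])).continuousAt
    have hcomm := ContinuousLinearMap.intervalIntegral_comp_comm (𝕜 := ℝ) imCLM hint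
    simp only [imCLM_apply] at hcomm
    rw [← hcomm]
    have hzero : EqOn (fun x : ℝ ↦ (G (x + (0 : ℝ) * I)).im) (fun _ ↦ 0) (uIcc (1 / 2 : ℝ) 2) := by
      intro x _
      have e : (x : ℂ) + (0 : ℝ) * I = (x : ℂ) := by simp
      simp only [e, hG]
      rw [show (2 : ℂ) * x = ((2 * x : ℝ) : ℂ) by push_cast; ring, mul_im, logDeriv_riemannXi_ofReal_im]
      simp
    rw [intervalIntegral.integral_congr hzero]
    simp
  -- left edge: `ϑ_ξ(2T)`
  have hleft : (I * ∫ y in (0 : ℝ)..T, G ((1 / 2 : ℝ) + y * I)).im = xiArg (2 * T) := by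
    have hint : IntervalIntegrable (fun y : ℝ ↦ G ((1 / 2 : ℝ) + y * I)) volume 0 T :=
      Literature.Analysis.Complex.intervalIntegrable_of_continuousAt_vertical (F := G) (1 / 2) hT
        fun y _ ↦ (hGd _ (by simp)).continuousAt
    rw [mul_im, I_re, I_im, zero_mul, one_mul, zero_add]
    have hcomm := ContinuousLinearMap.intervalIntegral_comp_comm (𝕜 := ℝ) reCLM hint
    simp only [reCLM_apply] at hcomm
    rw [← hcomm, xiArg_def]
    have e : ∀ y : ℝ, (G ((1 / 2 : ℝ) + y * I)).re = 2 * (logDeriv riemannXi (1 + ((2 * y : ℝ) : ℂ) * I)).re := by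
      intro y
      simp only [hG]
      rw [show (2 : ℂ) * (((1 / 2 : ℝ) : ℂ) + y * I) = 1 + ((2 * y : ℝ) : ℂ) * I by push_cast; ring]
      simp
    simp_rw [e]
    rw [intervalIntegral.integral_const_mul,
      intervalIntegral.integral_comp_mul_left (fun u : ℝ ↦ (logDeriv riemannXi (1 + (u : ℂ) * I)).re) two_ne_zero]
    simp
  have him := congrArg Complex.im hCG
  simp only [sub_im, add_im, zero_im] at him
  rw [hbot, hleft] at him
  have e2 : ∀ y : ℝ, G (2 + y * I) = 2 * logDeriv riemannXi (2 * (2 + (y : ℂ) * I)) := fun y ↦ rfl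
  have e3 : ∀ x : ℝ, G (x + T * I) = 2 * logDeriv riemannXi (2 * ((x : ℂ) + T * I)) := fun x ↦ rfl
  simp only [mul_im, I_re, I_im, zero_mul, one_mul, zero_add] at him
  linarith

/-! ## `∮_{∂R} M_z'/M_z = 4i(θ_k(T) + π)` -/

/-- **The variation of `arg M_z` along `∂R`** (`R = [−1, 2] × [−T, T]`, `k ≥ 3`, `T ≥ 2`,
`f(½ + iT) > 0`): `∮_{∂R} M_z'/M_z = 4i(θ_k(T) + π)`; with `θ_k(T) = 2πm` this is `2πi(4m + 2)`.
[cite: Stark1967EpsteinZeros, §3 Lemma 5] -/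
theorem rectBoundaryIntegral_logDeriv_epsteinMain (z : ℍ) (hk : 3 ≤ z.im) {T : ℝ} (hT : 2 ≤ T)
    (hpos : starkF z (1 / 2 + T * I) = ‖starkF z (1 / 2 + T * I)‖) :
    rectBoundaryIntegral (fun s ↦ deriv (epsteinMain z) s / epsteinMain z s) (-1) 2 (-T) T =
      4 * I * ((starkTheta z.im T + π : ℝ) : ℂ) := by
  have hy : 1 ≤ z.im := by linarith
  have hT0 : 0 < T := by linarith
  have hT1 : 1 ≤ T := by linarith
  set M := epsteinMain z with hM
  set F : ℂ → ℂ := fun s ↦ deriv M s / M s with hF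
  have hMd : Differentiable ℂ M := differentiable_epsteinMain z hy
  have hFc : ∀ s, M s ≠ 0 → ContinuousAt F s := fun s hs ↦
    (hMd.analyticAt s).deriv.continuousAt.div (hMd s).continuousAt hs
  -- `M ≠ 0` on the right and top edges
  have hMr : ∀ y : ℝ, M (2 + y * I) ≠ 0 := fun y ↦ epsteinMain_ne_zero_right z hk y
  have hMt : ∀ x ∈ Icc (-1 : ℝ) 2, M (x + T * I) ≠ 0 := fun x hx ↦ epsteinMain_ne_zero_top' z hk hT1 hpos hx
  -- folding
  have hfold := rectBoundaryIntegral_eq_of_symmetric (F := F) (T := T) hT0.le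
    (fun s ↦ logDerivM_one_sub z hy s) (fun s ↦ logDerivM_conj z s)
    (fun y _ ↦ hFc _ (hMr y)) (fun x hx ↦ hFc _ (hMt x hx))
  rw [hfold]
  congr 1
  -- the quarter-boundary points
  set H : ℂ → ℂ := fun w ↦ 1 + (starkF z (1 - w) / starkF z w) with hH
  have hptR : ∀ y : ℝ, (2 : ℂ) + y * I ≠ 0 ∧ (2 : ℂ) + y * I ≠ 1 ∧ (2 : ℂ) + y * I ≠ 1 / 2 ∧
      starkF z (2 + y * I) ≠ 0 ∧ H (2 + y * I) ∈ slitPlane := by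
    intro y
    refine ⟨?_, ?_, ?_, ?_, one_add_starkRho_right_mem z (by linarith) y⟩
    · intro h; have := congrArg Complex.re h; norm_num at this
    · intro h; have := congrArg Complex.re h; norm_num at this
    · intro h; have := congrArg Complex.re h; norm_num at this
    · exact starkF_ne_zero z (by norm_num) (fun h ↦ by have := congrArg Complex.re h; norm_num at this)
  have hptT : ∀ x ∈ Icc (1 / 2 : ℝ) 2, (x : ℂ) + T * I ≠ 0 ∧ (x : ℂ) + T * I ≠ 1 ∧ (x : ℂ) + T * I ≠ 1 / 2 ∧
      starkF z (x + T * I) ≠ 0 ∧ H (x + T * I) ∈ slitPlane := by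
    intro x hx
    refine ⟨?_, ?_, ?_, ?_, one_add_starkRho_top_mem z hk hT1 hpos hx⟩
    · intro h; have := congrArg Complex.im h; simp at this; linarith
    · intro h; have := congrArg Complex.im h; simp at this; linarith
    · intro h; have := congrArg Complex.im h; simp at this; linarith
    · exact starkF_ne_zero z (by simpa using hx.1)
        (fun h ↦ by have := congrArg Complex.im h; simp at this; linarith)
  -- the decomposition on the two edges
  have hdec : ∀ s : ℂ, s ≠ 0 → s ≠ 1 → s ≠ 1 / 2 → starkF z s ≠ 0 → H s ∈ slitPlane →
      F s = (Real.log z.im : ℂ) + 2 * logDeriv riemannXi (2 * s) + (s - 1)⁻¹ - (s - 1 / 2)⁻¹ +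
        deriv H s / H s := by
    intro s h0 h1 hh hf hs
    have := logDeriv_epsteinMain_eq z hy h0 h1 hh hf (slitPlane_ne_zero hs)
    simpa only [hF, hM, hH, logDeriv_apply] using this
  -- analyticity of `H` at the edge points
  have hHa : ∀ s : ℂ, s ≠ 0 → s ≠ 1 → s ≠ 1 / 2 → starkF z s ≠ 0 → AnalyticAt ℂ H s :=
    fun s h0 h1 hh hf ↦ analyticAt_const.add (analyticAt_starkRho z h0 h1 hh hf)
  -- integrability of the pieces on the right edge
  have iR1 : IntervalIntegrable (fun _ : ℝ ↦ (Real.log z.im : ℂ)) volume 0 T := intervalIntegrable_const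
  have iR2 : IntervalIntegrable (fun y : ℝ ↦ 2 * logDeriv riemannXi (2 * (2 + (y : ℂ) * I))) volume 0 T := by
    have := Literature.Analysis.Complex.intervalIntegrable_of_continuousAt_vertical
      (F := fun w : ℂ ↦ 2 * logDeriv riemannXi (2 * w)) 2 hT0.le fun y _ ↦
        (differentiableAt_two_mul_logDeriv_xi (by norm_num)).continuousAt
    simpa using this
  have iR3 : IntervalIntegrable (fun y : ℝ ↦ (2 + (y : ℂ) * I - 1)⁻¹) volume 0 T := by
    refine (Continuous.inv₀ (by fun_prop) fun y h ↦ ?_).intervalIntegrable _ _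
    have := congrArg Complex.re h; norm_num at this
  have iR4 : IntervalIntegrable (fun y : ℝ ↦ (2 + (y : ℂ) * I - 1 / 2)⁻¹) volume 0 T := by
    refine (Continuous.inv₀ (by fun_prop) fun y h ↦ ?_).intervalIntegrable _ _
    have := congrArg Complex.re h; norm_num at this
  have iR5 : IntervalIntegrable (fun y : ℝ ↦ deriv H (2 + y * I) / H (2 + y * I)) volume 0 T := by
    have := Literature.Analysis.Complex.intervalIntegrable_of_continuousAt_vertical
      (F := fun w : ℂ ↦ deriv H w / H w) 2 hT0.le fun y _ ↦ by
        obtain ⟨h0, h1, hh, hf, hs⟩ := hptR y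
        have ha := hHa _ h0 h1 hh hf
        exact ha.deriv.continuousAt.div ha.continuousAt (slitPlane_ne_zero hs)
    simpa using this
  -- integrability of the pieces on the top edge
  have iT1 : IntervalIntegrable (fun _ : ℝ ↦ (Real.log z.im : ℂ)) volume (1 / 2) 2 := intervalIntegrable_const
  have iT2 : IntervalIntegrable (fun x : ℝ ↦ 2 * logDeriv riemannXi (2 * ((x : ℂ) + T * I))) volume (1 / 2) 2 :=
    Literature.Analysis.Complex.intervalIntegrable_of_continuousAt_horizontal
      (F := fun w : ℂ ↦ 2 * logDeriv riemannXi (2 * w)) T (by norm_num) fun x hx ↦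
        (differentiableAt_two_mul_logDeriv_xi (by simp; linarith [hx.1])).continuousAt
  have iT3 : IntervalIntegrable (fun x : ℝ ↦ ((x : ℂ) + T * I - 1)⁻¹) volume (1 / 2) 2 := by
    refine (Continuous.inv₀ (by fun_prop) fun x h ↦ ?_).intervalIntegrable _ _
    have := congrArg Complex.im h; simp at this; linarith
  have iT4 : IntervalIntegrable (fun x : ℝ ↦ ((x : ℂ) + T * I - 1 / 2)⁻¹) volume (1 / 2) 2 := by
    refine (Continuous.inv₀ (by fun_prop) fun x h ↦ ?_).intervalIntegrable _ _
    have := congrArg Complex.im h; simp at this; linarith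
  have iT5 : IntervalIntegrable (fun x : ℝ ↦ deriv H (x + T * I) / H (x + T * I)) volume (1 / 2) 2 :=
    Literature.Analysis.Complex.intervalIntegrable_of_continuousAt_horizontal
      (F := fun w : ℂ ↦ deriv H w / H w) T (by norm_num) fun x hx ↦ by
        obtain ⟨h0, h1, hh, hf, hs⟩ := hptT x hx
        have ha := hHa _ h0 h1 hh hf
        exact ha.deriv.continuousAt.div ha.continuousAt (slitPlane_ne_zero hs)
  -- the right-edge integral
  have hCdec : ∫ y in (0 : ℝ)..T, F (2 + y * I) =
      (∫ y in (0 : ℝ)..T, (Real.log z.im : ℂ)) +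
      (∫ y in (0 : ℝ)..T, 2 * logDeriv riemannXi (2 * (2 + (y : ℂ) * I))) +
      (∫ y in (0 : ℝ)..T, (2 + (y : ℂ) * I - 1)⁻¹) -
      (∫ y in (0 : ℝ)..T, (2 + (y : ℂ) * I - 1 / 2)⁻¹) +
      (∫ y in (0 : ℝ)..T, deriv H (2 + y * I) / H (2 + y * I)) := by
    rw [← integral_add iR1 iR2, ← integral_add (iR1.add iR2) iR3, ← integral_sub ((iR1.add iR2).add iR3) iR4,
      ← integral_add (((iR1.add iR2).add iR3).sub iR4) iR5]
    refine intervalIntegral.integral_congr fun y _ ↦ ?_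
    obtain ⟨h0, h1, hh, hf, hs⟩ := hptR y
    exact hdec _ h0 h1 hh hf hs
  have hBdec : ∫ x in (1 / 2 : ℝ)..2, F (x + T * I) =
      (∫ x in (1 / 2 : ℝ)..2, (Real.log z.im : ℂ)) +
      (∫ x in (1 / 2 : ℝ)..2, 2 * logDeriv riemannXi (2 * ((x : ℂ) + T * I))) +
      (∫ x in (1 / 2 : ℝ)..2, ((x : ℂ) + T * I - 1)⁻¹) -
      (∫ x in (1 / 2 : ℝ)..2, ((x : ℂ) + T * I - 1 / 2)⁻¹) +
      (∫ x in (1 / 2 : ℝ)..2, deriv H (x + T * I) / H (x + T * I)) := by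
    rw [← integral_add iT1 iT2, ← integral_add (iT1.add iT2) iT3, ← integral_sub ((iT1.add iT2).add iT3) iT4,
      ← integral_add (((iT1.add iT2).add iT3).sub iT4) iT5]
    refine intervalIntegral.integral_congr fun x hx ↦ ?_
    rw [uIcc_of_le (by norm_num)] at hx
    obtain ⟨h0, h1, hh, hf, hs⟩ := hptT x hx
    exact hdec _ h0 h1 hh hf hs
  -- `∫ Re = Re ∫` on the right edge
  have hCre : (∫ y in (0 : ℝ)..T, (F (2 + y * I)).re) = (∫ y in (0 : ℝ)..T, F (2 + y * I)).re := by
    have hint : IntervalIntegrable (fun y : ℝ ↦ F (2 + y * I)) volume 0 T := by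
      have := Literature.Analysis.Complex.intervalIntegrable_of_continuousAt_vertical (F := F) 2 hT0.le fun y _ ↦
        hFc _ (hMr y)
      simpa using this
    have := ContinuousLinearMap.intervalIntegral_comp_comm (𝕜 := ℝ) reCLM hint
    simpa using this
  -- piece 1: the constant `log k`
  have p1C : (∫ y in (0 : ℝ)..T, (Real.log z.im : ℂ)) = ((T * Real.log z.im : ℝ) : ℂ) := by
    rw [intervalIntegral.integral_const]; push_cast; simp
  have p1B : (∫ x in (1 / 2 : ℝ)..2, (Real.log z.im : ℂ)) = (((2 - 1 / 2) * Real.log z.im : ℝ) : ℂ) := by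
    rw [intervalIntegral.integral_const]; push_cast; simp
  -- piece 5: `H = 1 + ρ`
  have p5C : I * (∫ y in (0 : ℝ)..T, deriv H (2 + y * I) / H (2 + y * I)) = log (H (2 + T * I)) - log (H (2 + (0 : ℝ) * I)) := by
    have := Literature.Analysis.Complex.integral_logDeriv_vertical (g := H) 2 (c := 0) (d := T) hT0.le
      (fun y _ ↦ by obtain ⟨h0, h1, hh, hf, -⟩ := hptR y; exact hHa _ h0 h1 hh hf)
      (fun y _ ↦ (hptR y).2.2.2.2)
    simpa using this
  have p5B : (∫ x in (1 / 2 : ℝ)..2, deriv H (x + T * I) / H (x + T * I)) =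
      log (H (2 + T * I)) - log (H ((1 / 2 : ℝ) + T * I)) := by
    have := Literature.Analysis.Complex.integral_logDeriv_horizontal (g := H) T (a := 1 / 2) (b := 2) (by norm_num)
      (fun x hx ↦ by obtain ⟨h0, h1, hh, hf, -⟩ := hptT x hx; exact hHa _ h0 h1 hh hf)
      (fun x hx ↦ (hptT x hx).2.2.2.2)
    simpa using this
  have hH2 : (log (H (2 + (0 : ℝ) * I))).im = 0 := by
    -- `ρ(2)` is real with `|ρ(2)| ≤ ¼`, so `1 + ρ(2) > 0`
    have e : (2 : ℂ) + (0 : ℝ) * I = 2 := by simp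
    rw [e, log_im]
    have hreal : ((starkF z (1 - 2) / starkF z 2)).im = 0 := by
      have h := starkRho_conj z 2
      rw [show conj (2 : ℂ) = 2 from map_ofNat _ 2] at h
      exact Complex.conj_eq_iff_im.1 h.symm
    have hsmall : |((starkF z (1 - 2) / starkF z 2)).re| ≤ 1 / 4 := by
      have := norm_starkRho_right_le z (by linarith) 0
      simp only [ofReal_zero, zero_mul, add_zero] at this
      exact (abs_re_le_norm _).trans this
    have hH : H 2 = ((1 + ((starkF z (1 - 2) / starkF z 2)).re : ℝ) : ℂ) := by
      apply Complex.ext <;> simp [hH, hreal]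
    rw [hH, arg_ofReal_of_nonneg]
    linarith [(abs_le.1 hsmall).1]
  have hHc : (log (H ((1 / 2 : ℝ) + T * I))).im = 0 := by
    have e : ((1 / 2 : ℝ) : ℂ) + T * I = 1 / 2 + T * I := by push_cast; ring
    rw [e, log_im]
    have : H (1 / 2 + T * I) = 2 := by
      simp only [hH, starkRho_corner z hT0 hpos]; norm_num
    rw [this]
    exact arg_ofReal_of_nonneg (by norm_num : (0 : ℝ) ≤ 2) ▸ by norm_num
  -- assemble
  have main : (∫ y in (0 : ℝ)..T, F (2 + y * I)).re - (∫ x in (1 / 2 : ℝ)..2, F (x + T * I)).im =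
      starkTheta z.im T + π := by
    rw [hCdec, hBdec]
    have h3 := piece_inv_sub_one hT0
    have h4 := piece_inv_sub_half hT0
    have h2 := piece_logDeriv_xi hT0.le
    set C2 : ℂ := ∫ y in (0 : ℝ)..T, 2 * logDeriv riemannXi (2 * (2 + (y : ℂ) * I))
    set C3 : ℂ := ∫ y in (0 : ℝ)..T, (2 + (y : ℂ) * I - 1)⁻¹
    set C4 : ℂ := ∫ y in (0 : ℝ)..T, (2 + (y : ℂ) * I - 1 / 2)⁻¹
    set C5 : ℂ := ∫ y in (0 : ℝ)..T, deriv H (2 + y * I) / H (2 + y * I)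
    set B2 : ℂ := ∫ x in (1 / 2 : ℝ)..2, 2 * logDeriv riemannXi (2 * ((x : ℂ) + T * I))
    set B3 : ℂ := ∫ x in (1 / 2 : ℝ)..2, ((x : ℂ) + T * I - 1)⁻¹
    set B4 : ℂ := ∫ x in (1 / 2 : ℝ)..2, ((x : ℂ) + T * I - 1 / 2)⁻¹
    set B5 : ℂ := ∫ x in (1 / 2 : ℝ)..2, deriv H (x + T * I) / H (x + T * I)
    have h5C : C5.re = (log (H (2 + T * I))).im - (log (H (2 + (0 : ℝ) * I))).im := by
      have := congrArg Complex.im p5C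
      simp only [mul_im, I_re, I_im, zero_mul, one_mul, zero_add, sub_im] at this
      exact this
    have h5B : B5.im = (log (H (2 + T * I))).im - (log (H ((1 / 2 : ℝ) + T * I))).im := by
      have := congrArg Complex.im p5B
      simpa only [sub_im] using this
    rw [p1C, p1B]
    simp only [add_re, sub_re, add_im, sub_im, ofReal_re, ofReal_im]
    rw [h5C, h5B, hH2, hHc, starkTheta_def]
    linarith
  rw [hCre]
  exact_mod_cast main

/-! ## From `M_z` to `P_z` (Rouché) and the argument principle -/

/-- The Rouché inequality `|P_z − M_z| < |M_z|` is symmetric under `s ↦ s̄`. [folklore] -/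
theorem epsteinDom_conj_iff (z : ℍ) (s : ℂ) :
    ‖epsteinP z (conj s) - epsteinMain z (conj s)‖ < ‖epsteinMain z (conj s)‖ ↔
      ‖epsteinP z s - epsteinMain z s‖ < ‖epsteinMain z s‖ := by
  rw [epsteinP_conj, epsteinMain_conj, ← map_sub, Complex.norm_conj, Complex.norm_conj]

/-- The Rouché inequality `|P_z − M_z| < |M_z|` is symmetric under `s ↦ 1 − s`. [folklore] -/
theorem epsteinDom_one_sub_iff (z : ℍ) (s : ℂ) :
    ‖epsteinP z (1 - s) - epsteinMain z (1 - s)‖ < ‖epsteinMain z (1 - s)‖ ↔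
      ‖epsteinP z s - epsteinMain z s‖ < ‖epsteinMain z s‖ := by
  rw [epsteinP_one_sub, epsteinMain_one_sub]

/-- From the quarter boundary `2 → 2 + iT → ½ + iT` to all of `∂R`, `R = [−1, 2] × [−T, T]`.
[cite: Stark1967EpsteinZeros, §3 Lemma 5 (proof)] -/
theorem epsteinDom_boundary (z : ℍ) {T : ℝ}
    (hEr : ∀ y ∈ Icc (0 : ℝ) T, ‖epsteinP z (2 + y * I) - epsteinMain z (2 + y * I)‖ < ‖epsteinMain z (2 + y * I)‖)
    (hEt : ∀ x ∈ Icc (1 / 2 : ℝ) 2, ‖epsteinP z (x + T * I) - epsteinMain z (x + T * I)‖ < ‖epsteinMain z (x + T * I)‖) :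
    (∀ x ∈ Icc (-1 : ℝ) 2, ‖epsteinP z (x + (-T : ℝ) * I) - epsteinMain z (x + (-T : ℝ) * I)‖ <
        ‖epsteinMain z (x + (-T : ℝ) * I)‖) ∧
    (∀ x ∈ Icc (-1 : ℝ) 2, ‖epsteinP z (x + T * I) - epsteinMain z (x + T * I)‖ < ‖epsteinMain z (x + T * I)‖) ∧
    (∀ y ∈ Icc (-T) T, ‖epsteinP z ((-1 : ℝ) + y * I) - epsteinMain z ((-1 : ℝ) + y * I)‖ <
        ‖epsteinMain z ((-1 : ℝ) + y * I)‖) ∧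
    (∀ y ∈ Icc (-T) T, ‖epsteinP z ((2 : ℝ) + y * I) - epsteinMain z ((2 : ℝ) + y * I)‖ <
        ‖epsteinMain z ((2 : ℝ) + y * I)‖) := by
  -- top edge
  have htop : ∀ x ∈ Icc (-1 : ℝ) 2, ‖epsteinP z (x + T * I) - epsteinMain z (x + T * I)‖ <
      ‖epsteinMain z (x + T * I)‖ := by
    intro x hx
    rcases le_or_gt (1 / 2 : ℝ) x with h | h
    · exact hEt x ⟨h, hx.2⟩
    · have e : (x : ℂ) + T * I = 1 - conj (((1 - x : ℝ) : ℂ) + T * I) := by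
        apply Complex.ext <;> simp
      rw [e, epsteinDom_one_sub_iff, epsteinDom_conj_iff]
      exact hEt (1 - x) ⟨by linarith, by linarith [hx.1]⟩
  -- right edge
  have hright : ∀ y ∈ Icc (-T) T, ‖epsteinP z ((2 : ℝ) + y * I) - epsteinMain z ((2 : ℝ) + y * I)‖ <
      ‖epsteinMain z ((2 : ℝ) + y * I)‖ := by
    intro y hy
    rcases le_or_gt 0 y with h | h
    · simpa using hEr y ⟨h, hy.2⟩
    · have e : ((2 : ℝ) : ℂ) + y * I = conj (2 + ((-y : ℝ) : ℂ) * I) := by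
        apply Complex.ext <;> simp
      rw [e, epsteinDom_conj_iff]
      exact hEr (-y) ⟨by linarith, by linarith [hy.1]⟩
  refine ⟨fun x hx ↦ ?_, htop, fun y hy ↦ ?_, hright⟩
  · have e : (x : ℂ) + ((-T : ℝ) : ℂ) * I = conj ((x : ℂ) + T * I) := by
      apply Complex.ext <;> simp
    rw [e, epsteinDom_conj_iff]
    exact htop x hx
  · have e : ((-1 : ℝ) : ℂ) + y * I = 1 - (((2 : ℝ) : ℂ) + ((-y : ℝ) : ℂ) * I) := by
      apply Complex.ext <;> simp; norm_num
    rw [e, epsteinDom_one_sub_iff]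
    exact hright (-y) ⟨by linarith [hy.2], by linarith [hy.1]⟩

/-- At a point where `|P_z − M_z| < |M_z|`: `M_z ≠ 0`, `P_z ≠ 0`, `P_z/M_z` has positive real part.
[folklore] -/
theorem epsteinDom_pointwise (z : ℍ) {s : ℂ} (h : ‖epsteinP z s - epsteinMain z s‖ < ‖epsteinMain z s‖) :
    epsteinMain z s ≠ 0 ∧ epsteinP z s ≠ 0 ∧ epsteinP z s / epsteinMain z s ∈ slitPlane := by
  have hM : epsteinMain z s ≠ 0 := by
    intro h0; rw [h0, norm_zero] at h; exact absurd h (not_lt.2 (norm_nonneg _))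
  have hP : epsteinP z s ≠ 0 := by
    intro h0
    rw [h0, zero_sub, norm_neg] at h
    exact lt_irrefl _ h
  refine ⟨hM, hP, ?_⟩
  have hlt : ‖epsteinP z s / epsteinMain z s - 1‖ < 1 := by
    rw [show epsteinP z s / epsteinMain z s - 1 = (epsteinP z s - epsteinMain z s) / epsteinMain z s by
      field_simp, norm_div, div_lt_one (norm_pos_iff.2 hM)]
    exact h
  have h1 : |(epsteinP z s / epsteinMain z s - 1).re| < 1 := (abs_re_le_norm _).trans_lt hlt
  rw [sub_re, one_re] at h1
  exact Or.inl (by linarith [(abs_lt.1 h1).1])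

/-- **Rouché's theorem for `P_z = M_z + s(s−1)E_z`**: if `|P_z − M_z| < |M_z|` on the quarter
boundary, then `∮_{∂R} P_z'/P_z = ∮_{∂R} M_z'/M_z = 4i(θ_k(T) + π)` (`P_z/M_z` has positive real part
on `∂R`, so its logarithm returns to its initial value). [cite: Stark1967EpsteinZeros, §3 Lemma 5] -/
theorem rectBoundaryIntegral_logDeriv_epsteinP (z : ℍ) (hk : 3 ≤ z.im) {T : ℝ} (hT : 2 ≤ T)
    (hpos : starkF z (1 / 2 + T * I) = ‖starkF z (1 / 2 + T * I)‖)
    (hEr : ∀ y ∈ Icc (0 : ℝ) T, ‖epsteinP z (2 + y * I) - epsteinMain z (2 + y * I)‖ < ‖epsteinMain z (2 + y * I)‖)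
    (hEt : ∀ x ∈ Icc (1 / 2 : ℝ) 2, ‖epsteinP z (x + T * I) - epsteinMain z (x + T * I)‖ < ‖epsteinMain z (x + T * I)‖) :
    rectBoundaryIntegral (fun s ↦ deriv (epsteinP z) s / epsteinP z s) (-1) 2 (-T) T =
      4 * I * ((starkTheta z.im T + π : ℝ) : ℂ) := by
  have hy : 1 ≤ z.im := by linarith
  have hT0 : 0 < T := by linarith
  obtain ⟨hDb, hDt, hDl, hDr⟩ := epsteinDom_boundary z hEr hEt
  set P := epsteinP z with hP
  set M := epsteinMain z with hM
  set g : ℂ → ℂ := fun s ↦ P s / M s with hg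
  have hPd : Differentiable ℂ P := differentiable_epsteinP z
  have hMd : Differentiable ℂ M := differentiable_epsteinMain z hy
  -- pointwise facts at a dominated point
  have key : ∀ s : ℂ, ‖P s - M s‖ < ‖M s‖ →
      AnalyticAt ℂ g s ∧ g s ∈ slitPlane ∧
      deriv P s / P s = deriv M s / M s + deriv g s / g s ∧
      ContinuousAt (fun w ↦ deriv M w / M w) s ∧ ContinuousAt (fun w ↦ deriv g w / g w) s ∧
      ContinuousAt (fun w ↦ deriv P w / P w) s := by
    intro s hs
    obtain ⟨hM0, hP0, hsl⟩ := epsteinDom_pointwise z hs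
    have hga : AnalyticAt ℂ g s := (hPd.analyticAt s).div (hMd.analyticAt s) hM0
    have hg0 : g s ≠ 0 := slitPlane_ne_zero hsl
    have hld : logDeriv g s = logDeriv P s - logDeriv M s :=
      logDeriv_div (f := P) (g := M) s hP0 hM0 (hPd s) (hMd s)
    refine ⟨hga, hsl, ?_, ?_, ?_, ?_⟩
    · simp only [logDeriv_apply] at hld
      rw [hld]; ring
    · exact (hMd.analyticAt s).deriv.continuousAt.div (hMd s).continuousAt hM0
    · exact hga.deriv.continuousAt.div hga.continuousAt hg0
    · exact (hPd.analyticAt s).deriv.continuousAt.div (hPd s).continuousAt hP0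
  -- `∮ g'/g = 0`
  have h0 := Literature.Analysis.Complex.integral_boundary_rect_logDeriv_eq_zero_of_mem_slitPlane (g := g)
    (a := -1) (b := 2) (c := -T) (d := T) (by norm_num) (by linarith)
    (fun x hx ↦ (key _ (hDb x hx)).1) (fun x hx ↦ (key _ (hDt x hx)).1)
    (fun y hy ↦ (key _ (hDl y hy)).1) (fun y hy ↦ (key _ (hDr y hy)).1)
    (fun x hx ↦ (key _ (hDb x hx)).2.1) (fun x hx ↦ (key _ (hDt x hx)).2.1)
    (fun y hy ↦ (key _ (hDl y hy)).2.1) (fun y hy ↦ (key _ (hDr y hy)).2.1)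
  have h0' : rectBoundaryIntegral (fun s ↦ deriv g s / g s) (-1) 2 (-T) T = 0 := by
    rw [rectBoundaryIntegral_def]; exact_mod_cast h0
  have hcongr : rectBoundaryIntegral (fun s ↦ deriv P s / P s) (-1) 2 (-T) T =
      rectBoundaryIntegral (fun s ↦ deriv M s / M s + deriv g s / g s) (-1) 2 (-T) T :=
    rectBoundaryIntegral_congr (by norm_num) (by linarith)
      (fun x hx ↦ (key _ (hDb x hx)).2.2.1) (fun x hx ↦ (key _ (hDt x hx)).2.2.1)
      (fun y hy ↦ (key _ (hDl y hy)).2.2.1) (fun y hy ↦ (key _ (hDr y hy)).2.2.1)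
  have hadd := rectBoundaryIntegral_add (F := fun s ↦ deriv M s / M s) (G := fun s ↦ deriv g s / g s)
    (a := -1) (b := 2) (c := -T) (d := T) (by norm_num) (by linarith)
    (fun x hx ↦ (key _ (hDb x hx)).2.2.2.1) (fun x hx ↦ (key _ (hDt x hx)).2.2.2.1)
    (fun y hy ↦ (key _ (hDl y hy)).2.2.2.1) (fun y hy ↦ (key _ (hDr y hy)).2.2.2.1)
    (fun x hx ↦ (key _ (hDb x hx)).2.2.2.2.1) (fun x hx ↦ (key _ (hDt x hx)).2.2.2.2.1)
    (fun y hy ↦ (key _ (hDl y hy)).2.2.2.2.1) (fun y hy ↦ (key _ (hDr y hy)).2.2.2.2.1)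
  rw [hcongr, hadd, h0', add_zero, hM]
  exact rectBoundaryIntegral_logDeriv_epsteinMain z hk hT hpos

/-- `θ_k(T) = 2πm` means `f(½ + iT) > 0`. [cite: Stark1967EpsteinZeros, §3 Lemma 3] -/
theorem starkF_corner_pos (z : ℍ) {T : ℝ} (hT : 0 < T) {m : ℤ} (hθ : starkTheta z.im T = 2 * π * m) :
    starkF z (1 / 2 + T * I) = ‖starkF z (1 / 2 + T * I)‖ := by
  have h := starkF_critical_eq_norm_mul_exp z hT
  rw [hθ] at h
  have e : Complex.exp (((2 * π * m : ℝ) : ℂ) * I) = 1 := by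
    rw [show ((2 * π * m : ℝ) : ℂ) * I = (m : ℂ) * (2 * π * I) by push_cast; ring]
    exact Complex.exp_int_mul_two_pi_mul_I m
  rw [e, mul_one] at h
  exact h

/-- `P_z ≠ 0` on `∂R` under the Rouché hypothesis. [cite: Stark1967EpsteinZeros, §3 Lemma 5] -/
theorem epsteinP_ne_zero_boundary (z : ℍ) {T : ℝ}
    (hEr : ∀ y ∈ Icc (0 : ℝ) T, ‖epsteinP z (2 + y * I) - epsteinMain z (2 + y * I)‖ < ‖epsteinMain z (2 + y * I)‖)
    (hEt : ∀ x ∈ Icc (1 / 2 : ℝ) 2, ‖epsteinP z (x + T * I) - epsteinMain z (x + T * I)‖ < ‖epsteinMain z (x + T * I)‖) :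
    (∀ x ∈ Icc (-1 : ℝ) 2, epsteinP z (x + (-T : ℝ) * I) ≠ 0) ∧
    (∀ x ∈ Icc (-1 : ℝ) 2, epsteinP z (x + T * I) ≠ 0) ∧
    (∀ y ∈ Icc (-T) T, epsteinP z ((-1 : ℝ) + y * I) ≠ 0) ∧
    (∀ y ∈ Icc (-T) T, epsteinP z ((2 : ℝ) + y * I) ≠ 0) := by
  obtain ⟨hDb, hDt, hDl, hDr⟩ := epsteinDom_boundary z hEr hEt
  exact ⟨fun x hx ↦ (epsteinDom_pointwise z (hDb x hx)).2.1, fun x hx ↦ (epsteinDom_pointwise z (hDt x hx)).2.1,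
    fun y hy ↦ (epsteinDom_pointwise z (hDl y hy)).2.1, fun y hy ↦ (epsteinDom_pointwise z (hDr y hy)).2.1⟩

/-- **Stark's Lemma 5 (the count).** For `k ≥ 3`, `T ≥ 2` with `θ_k(T) = 2πm` and the Rouché
hypothesis `|P_z − M_z| < |M_z|` on `2 → 2 + iT → ½ + iT`, the zeros of `P_z` (i.e. of `ζ(s, Q)`)
in the open rectangle `(−1, 2) × (−T, T)`, counted with multiplicity, number exactly `4m + 2`
(Stark: `N = 2n + 2`, `n = 2m`). [cite: Stark1967EpsteinZeros, §3 Lemma 5] -/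
theorem finsum_order_epsteinP_eq (z : ℍ) (hk : 3 ≤ z.im) {T : ℝ} (hT : 2 ≤ T) {m : ℤ}
    (hθ : starkTheta z.im T = 2 * π * m)
    (hEr : ∀ y ∈ Icc (0 : ℝ) T, ‖epsteinP z (2 + y * I) - epsteinMain z (2 + y * I)‖ < ‖epsteinMain z (2 + y * I)‖)
    (hEt : ∀ x ∈ Icc (1 / 2 : ℝ) 2, ‖epsteinP z (x + T * I) - epsteinMain z (x + T * I)‖ < ‖epsteinMain z (x + T * I)‖) :
    ∑ᶠ ρ ∈ {ρ : ℂ | epsteinP z ρ = 0 ∧ ρ ∈ Ioo (-1 : ℝ) 2 ×ℂ Ioo (-T) T},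
      ((meromorphicOrderAt (epsteinP z) ρ).untop₀ : ℂ) = 4 * m + 2 := by
  have hT0 : 0 < T := by linarith
  have hpos := starkF_corner_pos z hT0 hθ
  obtain ⟨hb, ht, hl, hr⟩ := epsteinP_ne_zero_boundary z hEr hEt
  have hPan : AnalyticOnNhd ℂ (epsteinP z) (Icc (-1 : ℝ) 2 ×ℂ Icc (-T) T) := fun s _ ↦
    (differentiable_epsteinP z).analyticAt s
  have hAP := Literature.Analysis.Complex.integral_boundary_rect_logDeriv (f := epsteinP z) (a := -1) (b := 2)
    (c := -T) (d := T) (by norm_num) (by linarith) hPan hb ht hl hr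
  have hR := rectBoundaryIntegral_logDeriv_epsteinP z hk hT hpos hEr hEt
  rw [rectBoundaryIntegral_def] at hR
  push_cast at hR hAP
  rw [hAP, hθ] at hR
  have h2πI : (2 * π * I : ℂ) ≠ 0 := by simp [Real.pi_ne_zero, I_ne_zero]
  apply mul_left_cancel₀ h2πI
  rw [hR]; push_cast; ring

end Literature.Barriers.RiemannHypothesis
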